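import Mathlib
import HarnessLib
import Literature.Analysis.FluidPDE.FluidComputerGadgetRobust
import Summits.NavierStokesRegularity.Statement
import Summits.NavierStokesRegularity.NavierStokesRegularity.Theorems.FluidComputerGadget

/-!
# `ns_blowup_of_robustGadgetLibrary` — the Clay (A) corollaries of the ROBUST fluid-computer interface

HONEST FRAMING: low prior, high value-of-information experiment on Tao's machine paradigm;
NOT a claim that NS blows up.

Summit-side twin of `Literature/Analysis/FluidPDE/FluidComputerGadgetRobust.lean` (p179371, commit
39d0bb5c3b3a): a `RobustGadgetLibrary ν σ` — a gadget library whose input classes are OPEN in the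
relative `L²` distance `l2DistSq` at radius `rho · √(level energy)` (the "robustness radius in a
stated norm" of SPEC-SHEET.md §2 (C′)) — refutes Clay (A) `NavierStokesRegularity`, and does so
STABLY: the Clay conclusion fails at EVERY smooth, divergence-free, rapidly decaying datum in the
`L²` ball of radius `rho · √E0` about the seed (`ns_clayA_fails_near_seed`), not just at one
hand-tuned datum. The strict-closure form (`ns_blowup_of_robustGadgetLibrary_of_strictClosure`)
takes the budget with room `gap` (`GadgetSpec.StrictClosure`), the hypothesis under which the
kicked (noise-injected) cascade of the Literature file also runs (`KickedRun.speed_unbounded`).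
No instance of `RobustGadgetLibrary ν σ` for true NS is claimed anywhere; cf. [cite: Tao2016AveragedNS,
§1.3] on noise-tolerant inviscid gates as the main difficulty of the programme.
-/

set_option linter.dupNamespace false -- nested layout Summit.<S>.<Sub>, Sub = S (D-0017)

namespace Summit.NavierStokesRegularity.NavierStokesRegularity.Theorems

open scoped ContDiff ENNReal
open Literature.Analysis.FluidPDE Literature.Analysis.FluidPDE.FluidComputer

/-- **`ns_blowup_of_robustGadgetLibrary`**: a robust gadget library for true NS (`ν > 0`) with
valid, closing specs above the efficiency threshold `s⁻¹ < eta` refutes Clay (A). One line: a robust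
library is in particular a `GadgetLibrary`. NOT a claim that NS blows up. -/
theorem ns_blowup_of_robustGadgetLibrary {ν : ℝ} (hν : 0 < ν) {σ : GadgetSpec} (hσ : σ.Valid)
    (hclos : σ.Closure) (hvisc : σ.s⁻¹ < σ.eta) (lib : RobustGadgetLibrary ν σ) :
    ¬ NavierStokesRegularity :=
  ns_blowup_of_gadgetLibrary hν hσ hclos hvisc lib.toGadgetLibrary

/-- Strict-closure form: the noise budget with room `lib.gap`
(`amp·radius + leak + dStar + eta·gap ≤ eta·radius`) implies `Closure`. -/
theorem ns_blowup_of_robustGadgetLibrary_of_strictClosure {ν : ℝ} (hν : 0 < ν) {σ : GadgetSpec}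
    (hσ : σ.Valid) (lib : RobustGadgetLibrary ν σ) (hclos : σ.StrictClosure lib.gap)
    (hvisc : σ.s⁻¹ < σ.eta) : ¬ NavierStokesRegularity :=
  ns_blowup_of_robustGadgetLibrary hν hσ (hclos.closure hσ lib.gap_pos.le) hvisc lib

/-- **`ns_clayA_fails_near_seed`** (STABLE refutation): for EVERY Clay-class datum `u₀` (smooth,
divergence-free, rapidly decaying) within relative `L²` distance `rho` of the seed —
`∫ ‖u₀ - seed‖² ≤ rho² · E0` — there is NO global smooth bounded-energy Navier–Stokes solution from
`u₀`. So a robust library exhibits an `L²`-open (within the Clay class) set of data on which the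
Clay (A) conclusion fails; this is `RobustGadgetLibrary.stable_blowup` re-exported at the summit. -/
theorem ns_clayA_fails_near_seed {ν : ℝ} {σ : GadgetSpec} (hσ : σ.Valid) (hclos : σ.Closure)
    (hvisc : σ.s⁻¹ < σ.eta) (lib : RobustGadgetLibrary ν σ) (u₀ : Vel) (h1 : ContDiff ℝ ∞ u₀)
    (h2 : NSWave0.IsDivFree u₀) (h3 : HasRapidSpatialDecay u₀)
    (h : l2DistSq u₀ lib.seed ≤ ENNReal.ofReal (lib.rho ^ 2 * lib.E0)) :
    ¬ ∃ (u : ℝ → Vel) (p : ℝ → E3 → ℝ), IsSmoothOnHalfSpace u ∧ IsSmoothOnHalfSpace p ∧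
      IsNavierStokesSolution ν 0 u₀ u p ∧ HasBoundedEnergy u :=
  lib.stable_blowup hσ hclos hvisc u₀ h1 h2 h3 h

/-- The stable refutation read at the summit: Clay (A) applied at any datum of the ball is
contradicted (in particular at the seed itself, `RobustGadgetLibrary.seed_mem_ball`). -/
theorem ns_blowup_near_seed {ν : ℝ} (hν : 0 < ν) {σ : GadgetSpec} (hσ : σ.Valid)
    (hclos : σ.Closure) (hvisc : σ.s⁻¹ < σ.eta) (lib : RobustGadgetLibrary ν σ) (u₀ : Vel)
    (h1 : ContDiff ℝ ∞ u₀) (h2 : NSWave0.IsDivFree u₀) (h3 : HasRapidSpatialDecay u₀)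
    (h : l2DistSq u₀ lib.seed ≤ ENNReal.ofReal (lib.rho ^ 2 * lib.E0)) :
    ¬ NavierStokesRegularity := fun hNS =>
  ns_clayA_fails_near_seed hσ hclos hvisc lib u₀ h1 h2 h3 h (hNS ν hν u₀ h1 h2 h3)

end Summit.NavierStokesRegularity.NavierStokesRegularity.Theorems
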